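import Literature.AlgebraicGeometry.Motives.AbelianVarietyGoodReductionConjugate
import Literature.AlgebraicGeometry.Motives.AbelianVarietyConjugateBaseChangeAlong
import HarnessLib

/-!
# Points of the Frobenius twist `A^{(q)}`: «residue action ⇒ relative Frobenius», and the projection formulas of
# the conjugate good-reduction datum — [Shimura 1998, §18.6 proof of Thm. 18.6, p. 129–130 «`(Y^σ)~ = Ỹ^f`, `(t^σ)~ = π(t̃)`»]

Topic `Literature/AlgebraicGeometry/Motives`, namespaces `Literature.AlgebraicGeometry.Motives[.AbelianVariety[.GoodReductionAt]]`.
THEOREMS ONLY (no definition, no named fact, no instance, no notation; net Literature debt 0).  Cell `hodgecm-mathlib`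
(D-0151), row II-1, edition E4 / Q5 («twisted-model reduction compatibility», hypothesis `hQ5` of
`Summits/…/Theorems/HCCMUnconditionalS5cPrimeOfTwistedReduction`), piece **P4** of the scoping memo
`SCOPE-E4-Q5-twistedReduction` (B-p15) as allocated 2026-08-28 (B-p09): the READING of a point of the special fibre of
the conjugate model `𝒳 ⊗_{𝓞_v, γᵥ} 𝓞_v` (B-p12 `GoodReductionAt.conjModel` / `conjOfSquares` / `conjFrob`, whose reduction IS
the Frobenius twist `Ã^{(q)}` through `conjReductionIso`) as the image of a point of `Ã` under the relative `q`-Frobenius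
`π = Ã.relFrobenius p n : Ã → Ã^{(q)}` (B-p12 `AbelianVarietyFrobeniusTwistVariety`).

* §1 `AbelianVariety.map_relFrobenius_eq_of_left_comp_twistFst` (+ `_iff`, `geomPointsMap_relFrobenius_eq_iff_…`): an
  `L`-point `Q` of `A^{(q)}` whose projection to `A` is `Spec Frobⁿ_L ≫ P` IS `π(P)` — the converse of the tree's
  `map_relFrobenius_left_comp_twistFst` (universal property of `A^{(q)} = A ×_{k, Frobⁿ} k`).
* §2 `baseChangeHomCompIso_{hom,inv}_app_left_comp_fst(_fst)`, `baseChangeHomCommIso_{hom,inv}_app_left_comp_fst_fst`: the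
  transitivity / exchange isomorphisms of base change of `AbelianVarietyGoodReductionConjugate` §1 commute with the (double)
  first projections (from the tree's `pullbackComp_{hom,inv}_app_left_comp_fst(_fst)`).
* §3 `GoodReductionAt.conjReductionIso_hom_left_comp_fst_fst` (and the `conjGenericNatIso` / `conjModel.genericIso` companions,
  and the `conjFrob` specialisations): `conjReductionIso` followed by the projections `(𝒳 ⊗_{γᵥ} 𝓞_v) ⊗ κ → 𝒳 ⊗_{γᵥ} 𝓞_v → 𝒳`
  is `pr : Ã^{(q)} → Ã` followed by `Ã ≅ 𝒳 ⊗ κ → 𝒳`; whence **`map_relFrobenius_eq_of_conjReductionIso`**: a `κ'`-point `Q_S` of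
  `Ã^{(q)}` whose image in `𝒳` (through `conjReductionIso` and the two projections) is `Spec Frobⁿ_{κ'} ≫` (the image of a
  `κ'`-point `Q_R` of `Ã` in `𝒳`) IS `π(Q_R)` — the form in which the twisted-model reduction map is read in (TW)/Q5.

HC_CM is proved only modulo the 7 printed citations until rung 0 closes.
-/

set_option autoImplicit false

-- Compositions through `((baseChangeHom φ).obj X).left = pullback X.hom (Spec φ)`, `IntegralModel.reductionAt` and the
-- induced-category homs of `AbelianVariety` are definitional only above `instances` transparency
-- (as in `AbelianVarietyGoodReductionConjugate`, `ProperIntegralPointsTwist`).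
set_option backward.isDefEq.respectTransparency false

noncomputable section

open CategoryTheory CategoryTheory.Limits AlgebraicGeometry

universe u

namespace Literature.AlgebraicGeometry.Motives

/-! ### §1. Points of `A^{(q)}` lying over `Spec Frobⁿ ≫ P` are `π(P)` -/

namespace AbelianVariety

section Points

variable {k : Type u} [Field k] (p : ℕ) [ExpChar k p] (n : ℕ) (A : AbelianVariety k)

/-- **«Residue action ⇒ relative Frobenius» on points**: an `L`-point `Q` of the Frobenius twist `A^{(q)}` whose
projection to `A` is `Spec Frobⁿ_L ≫ P` (the point `P` with coordinates raised to the `q`-th power) IS `π(P) = F_{A/k}(P)`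
— the universal property of `A^{(q)} = A ×_{k, Frobⁿ} k` (the second projection of both is the structure morphism of
`Spec L`).  Converse of the tree's `map_relFrobenius_left_comp_twistFst`; Shimura p. 130 «`(t^σ)~ = π(t̃)`».
[cite: Shimura1998, §18.6 proof of Thm. 18.6, p. 130] [cite: GortzWedhorn2020, Section (4.7)] -/
theorem map_relFrobenius_eq_of_left_comp_twistFst (L : Type u) [Field L] [Algebra k L] [ExpChar L p]
    (P : A.Points L) (Q : (A.frobeniusTwist p n).Points L)
    (h : Q.left ≫ twistFst p n A.X = Spec.map (CommRingCat.ofHom (iterateFrobenius L p n)) ≫ P.left) :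
    AlgPoints.map (A.relFrobenius p n).hom.hom.hom P = Q := by
  refine frobeniusTwistOver_hom_ext p n (X := A.X) ?_
  change (AlgPoints.map (A.relFrobenius p n).hom.hom.hom P).left ≫ twistFst p n A.X = Q.left ≫ twistFst p n A.X
  rw [h]
  exact map_relFrobenius_left_comp_twistFst p n A L P

/-- `π(P) = Q ↔ Q` lies over `Spec Frobⁿ_L ≫ P`. [cite: Shimura1998, §18.6 proof of Thm. 18.6, p. 130] -/
theorem map_relFrobenius_eq_iff_left_comp_twistFst (L : Type u) [Field L] [Algebra k L] [ExpChar L p]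
    (P : A.Points L) (Q : (A.frobeniusTwist p n).Points L) :
    AlgPoints.map (A.relFrobenius p n).hom.hom.hom P = Q ↔
      Q.left ≫ twistFst p n A.X = Spec.map (CommRingCat.ofHom (iterateFrobenius L p n)) ≫ P.left := by
  refine ⟨?_, map_relFrobenius_eq_of_left_comp_twistFst p n A L P Q⟩
  rintro rfl
  exact map_relFrobenius_left_comp_twistFst p n A L P

/-- The same on geometric points (`A.geomPoints = Additive A(k̄)`, `Hom.geomPointsMap π`): `π(x) = Q ↔ Q` lies over
`Spec Frobⁿ_{k̄} ≫ x`. [cite: Shimura1998, §18.6 proof of Thm. 18.6, p. 130] -/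
theorem geomPointsMap_relFrobenius_eq_iff_left_comp_twistFst [ExpChar (AlgebraicClosure k) p] (x : A.geomPoints)
    (Q : (A.frobeniusTwist p n).Points (AlgebraicClosure k)) :
    Hom.geomPointsMap (A.relFrobenius p n) x = Additive.ofMul Q ↔
      Q.left ≫ twistFst p n A.X =
        Spec.map (CommRingCat.ofHom (iterateFrobenius (AlgebraicClosure k) p n)) ≫ (Additive.toMul x).left := by
  rw [← map_relFrobenius_eq_iff_left_comp_twistFst p n A (AlgebraicClosure k) (Additive.toMul x) Q,
    ← Hom.geomPointsMap_apply]
  exact Additive.toMul.injective.eq_iff.symm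

end Points

end AbelianVariety

/-! ### §2. The transitivity / exchange isomorphisms of base change commute with the first projections

Kernel hygiene (cell lesson «F6», 2026-08-28): the components of these functor isomorphisms are never compared by `rfl`
against hand-written composites; every step is a rewrite whose functor-valued implicit arguments are unified from the
goal. -/

section BaseChangeComm

variable {R₁ R₂ R₃ : Type u} [CommRing R₁] [CommRing R₂] [CommRing R₃]

/-- An `eqToHom` between base-change functors along EQUAL ring maps commutes with the first projections.
[cite: GortzWedhorn2020, Section (4.7)] -/
theorem eqToHom_baseChangeHom_app_left_comp_fst {ρ ρ' : R₁ →+* R₃} (h : ρ = ρ')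
    (E : baseChangeHom ρ = baseChangeHom ρ') (X : SchemeOver R₁) :
    ((eqToHom E).app X).left ≫ baseChangeHomFst ρ' X = baseChangeHomFst ρ X := by
  subst h
  rw [eqToHom_refl, NatTrans.id_app, Over.id_left, Category.id_comp]

/-- An `eqToIso` between `Over.pullback` functors along EQUAL morphisms commutes with the first projections.
[cite: GortzWedhorn2020, Section (4.7)] -/
theorem eqToIso_overPullback_hom_app_left_comp_fst {X Y : Scheme.{u}} {f g : X ⟶ Y} (h : f = g)
    (E : Over.pullback f = Over.pullback g) (W : Over Y) :
    ((eqToIso E).hom.app W).left ≫ pullback.fst W.hom g = pullback.fst W.hom f := by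
  subst h
  rw [eqToIso_refl, Iso.refl_hom, NatTrans.id_app, Over.id_left, Category.id_comp]

/-- **`X ⊗_{τσ} R₃ ≅ (X ⊗_σ R₂) ⊗_τ R₃` commutes with the projections to `X`**: the component of
`baseChangeHomCompIso σ τ` followed by the two first projections is the first projection of `X ⊗_{τσ} R₃`
(from the tree's `pullbackComp_hom_app_left_comp_fst_fst`). [cite: GortzWedhorn2020, Prop. 4.16 and §(4.7)] -/
@[reassoc]
theorem baseChangeHomCompIso_hom_app_left_comp_fst_fst (σ : R₁ →+* R₂) (τ : R₂ →+* R₃) (X : SchemeOver R₁) :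
    ((baseChangeHomCompIso σ τ).hom.app X).left ≫ baseChangeHomFst τ ((baseChangeHom σ).obj X) ≫
        baseChangeHomFst σ X = baseChangeHomFst (τ.comp σ) X := by
  have e1 : baseChangeHomFst τ ((baseChangeHom σ).obj X) ≫ baseChangeHomFst σ X =
      pullback.fst ((Over.pullback (Spec.map (CommRingCat.ofHom σ))).obj X).hom (Spec.map (CommRingCat.ofHom τ)) ≫
        pullback.fst X.hom (Spec.map (CommRingCat.ofHom σ)) := rfl
  have e2 : baseChangeHomFst (τ.comp σ) X = pullback.fst X.hom (Spec.map (CommRingCat.ofHom (τ.comp σ))) := rfl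
  rw [e1, e2, baseChangeHomCompIso, Iso.trans_hom, NatTrans.comp_app, Over.comp_left, Category.assoc,
    pullbackComp_hom_app_left_comp_fst_fst, eqToIso_overPullback_hom_app_left_comp_fst (specMap_ofHom_comp σ τ)]

/-- The inverse direction: `(baseChangeHomCompIso σ τ)⁻¹_X ≫ pr_X = pr ≫ pr_X`. [cite: GortzWedhorn2020, Prop. 4.16 and §(4.7)] -/
@[reassoc]
theorem baseChangeHomCompIso_inv_app_left_comp_fst (σ : R₁ →+* R₂) (τ : R₂ →+* R₃) (X : SchemeOver R₁) :
    ((baseChangeHomCompIso σ τ).inv.app X).left ≫ baseChangeHomFst (τ.comp σ) X =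
      baseChangeHomFst τ ((baseChangeHom σ).obj X) ≫ baseChangeHomFst σ X := by
  rw [← baseChangeHomCompIso_hom_app_left_comp_fst_fst σ τ X, ← Over.comp_left_assoc, Iso.inv_hom_id_app, Over.id_left,
    Category.id_comp]

/-- **The exchange isomorphism `(X ⊗_σ R₂) ⊗_τ R₃ ≅ (X ⊗_{σ'} R₂') ⊗_{τ'} R₃` (for `τσ = τ'σ'`) commutes with the
double first projections to `X`.** [cite: GortzWedhorn2020, Prop. 4.16 and §(4.7)] -/
@[reassoc]
theorem baseChangeHomCommIso_hom_app_left_comp_fst_fst {R₂' : Type u} [CommRing R₂'] (σ : R₁ →+* R₂) (τ : R₂ →+* R₃)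
    (σ' : R₁ →+* R₂') (τ' : R₂' →+* R₃) (h : τ.comp σ = τ'.comp σ') (X : SchemeOver R₁) :
    ((baseChangeHomCommIso σ τ σ' τ' h).hom.app X).left ≫ baseChangeHomFst τ' ((baseChangeHom σ').obj X) ≫
        baseChangeHomFst σ' X = baseChangeHomFst τ ((baseChangeHom σ).obj X) ≫ baseChangeHomFst σ X := by
  rw [baseChangeHomCommIso, Iso.trans_hom, Iso.trans_hom, NatTrans.comp_app, NatTrans.comp_app, Over.comp_left,
    Over.comp_left, Category.assoc, Category.assoc, baseChangeHomCompIso_hom_app_left_comp_fst_fst, Iso.symm_hom,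
    eqToIso.hom, eqToHom_baseChangeHom_app_left_comp_fst h, baseChangeHomCompIso_inv_app_left_comp_fst]

/-- The inverse direction of the exchange isomorphism against the double first projections.
[cite: GortzWedhorn2020, Prop. 4.16 and §(4.7)] -/
@[reassoc]
theorem baseChangeHomCommIso_inv_app_left_comp_fst_fst {R₂' : Type u} [CommRing R₂'] (σ : R₁ →+* R₂) (τ : R₂ →+* R₃)
    (σ' : R₁ →+* R₂') (τ' : R₂' →+* R₃) (h : τ.comp σ = τ'.comp σ') (X : SchemeOver R₁) :
    ((baseChangeHomCommIso σ τ σ' τ' h).inv.app X).left ≫ baseChangeHomFst τ ((baseChangeHom σ).obj X) ≫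
        baseChangeHomFst σ X = baseChangeHomFst τ' ((baseChangeHom σ').obj X) ≫ baseChangeHomFst σ' X := by
  rw [← baseChangeHomCommIso_hom_app_left_comp_fst_fst σ τ σ' τ' h X, ← Over.comp_left_assoc, Iso.inv_hom_id_app,
    Over.id_left, Category.id_comp]

end BaseChangeComm

/-! ### §3. The conjugate good-reduction datum: projection formulas and the reading of points of `Ã^{(q)}` -/

namespace AbelianVariety

namespace GoodReductionAt

open NumberField IsDedekindDomain IsDedekindDomain.HeightOneSpectrum

variable {K : Type} [Field K] [NumberField K] {A₀ : AbelianVariety K} {v : HeightOneSpectrum (𝓞 K)}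
  (R : A₀.GoodReductionAt v) (γ : K ≃+* K) (γᵥ : valuationSubringAtPrime K v ≃+* valuationSubringAtPrime K v)
  (h₁ : (algebraMap (valuationSubringAtPrime K v) K).comp γᵥ.toRingHom =
    γ.toRingHom.comp (algebraMap (valuationSubringAtPrime K v) K))
  (p n : ℕ) [ExpChar v.asIdeal.ResidueField p]
  (h₂ : (residueAt v).comp γᵥ.toRingHom = (iterateFrobenius v.asIdeal.ResidueField p n).comp (residueAt v))

/-- `conjGenericNatIso` against the double first projections: `(𝒳 ⊗_{γᵥ} 𝓞_v) ⊗ K → (𝒳 ⊗ K) ⊗_γ K → 𝒳 ⊗ K → 𝒳` equals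
`(𝒳 ⊗_{γᵥ} 𝓞_v) ⊗ K → 𝒳 ⊗_{γᵥ} 𝓞_v → 𝒳`. [cite: GortzWedhorn2020, Prop. 4.16 and §(4.7)] -/
@[reassoc]
theorem conjGenericNatIso_hom_app_left_comp_fst_fst (𝒳 : SchemeOver (valuationSubringAtPrime K v)) :
    ((conjGenericNatIso γ γᵥ h₁).hom.app 𝒳).left ≫
        baseChangeHomFst γ.toRingHom ((baseChangeHom (algebraMap (valuationSubringAtPrime K v) K)).obj 𝒳) ≫
          baseChangeHomFst (algebraMap (valuationSubringAtPrime K v) K) 𝒳 =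
      baseChangeHomFst (algebraMap (valuationSubringAtPrime K v) K) ((baseChangeHom γᵥ.toRingHom).obj 𝒳) ≫
        baseChangeHomFst γᵥ.toRingHom 𝒳 := by
  unfold conjGenericNatIso
  rw [baseChangeHomCommIso_hom_app_left_comp_fst_fst]

/-- `conjReductionNatIso` against the double first projections: `(𝒳 ⊗ κ) ⊗_{Frobⁿ} κ ≅ (𝒳 ⊗_{γᵥ} 𝓞_v) ⊗ κ` followed by
`→ 𝒳 ⊗_{γᵥ} 𝓞_v → 𝒳` is `(𝒳 ⊗ κ) ⊗_{Frobⁿ} κ → 𝒳 ⊗ κ → 𝒳`. [cite: GortzWedhorn2020, Prop. 4.16 and §(4.7)] -/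
@[reassoc]
theorem conjReductionNatIso_hom_app_left_comp_fst_fst (𝒳 : SchemeOver (valuationSubringAtPrime K v)) :
    ((conjReductionNatIso γᵥ p n h₂).hom.app 𝒳).left ≫
        baseChangeHomFst (residueAt v) ((baseChangeHom γᵥ.toRingHom).obj 𝒳) ≫ baseChangeHomFst γᵥ.toRingHom 𝒳 =
      baseChangeHomFst (iterateFrobenius v.asIdeal.ResidueField p n) ((baseChangeHom (residueAt v)).obj 𝒳) ≫
        baseChangeHomFst (residueAt v) 𝒳 := by
  unfold conjReductionNatIso
  rw [baseChangeHomCommIso_hom_app_left_comp_fst_fst]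

/-- **The generic isomorphism of the conjugate model against the projections**: `((𝒳 ⊗_{γᵥ} 𝓞_v) ⊗ K ≅ A₀^γ) → A₀`
(the conjugate's projection `A₀^γ = A₀ ⊗_γ K → A₀`) equals `(𝒳 ⊗_{γᵥ} 𝓞_v) ⊗ K → (𝒳 ⊗ K) ⊗_γ K → 𝒳 ⊗ K ≅ A₀` read
through `conjGenericNatIso`; equivalently, followed further by nothing: we record the form with the model's generic
isomorphism on the right. [cite: BombieriGubler2006, 10.3.9 (p. 334)] -/
@[reassoc]
theorem conjModel_genericIso_hom_left_comp_fst :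
    (conjModel R γ γᵥ h₁).genericIso.hom.left ≫ baseChangeHomFst γ.toRingHom A₀.X =
      ((conjGenericNatIso γ γᵥ h₁).hom.app R.model.total).left ≫
        baseChangeHomFst γ.toRingHom ((baseChangeHom (algebraMap (valuationSubringAtPrime K v) K)).obj R.model.total) ≫
          R.model.genericIso.hom.left := by
  rw [conjModel_genericIso_hom, Over.comp_left, Category.assoc]
  congr 1
  exact baseChangeHom_map_left_comp_fst γ.toRingHom R.model.genericIso.hom

/-- **`conjReductionIso` against the projections**: `Ã^{(q)} ≅ (𝒳 ⊗_{γᵥ} 𝓞_v) ⊗ κ → 𝒳 ⊗_{γᵥ} 𝓞_v → 𝒳` equals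
`pr : Ã^{(q)} → Ã` followed by `Ã ≅ 𝒳 ⊗ κ → 𝒳`. [cite: Shimura1998, §18.6 proof of Thm. 18.6, p. 129] -/
@[reassoc]
theorem conjReductionIso_hom_left_comp_fst_fst :
    (conjReductionIso R γ γᵥ h₁ p n h₂).hom.left ≫
        baseChangeHomFst (residueAt v) ((baseChangeHom γᵥ.toRingHom).obj R.model.total) ≫
          baseChangeHomFst γᵥ.toRingHom R.model.total =
      twistFst p n R.reduction.X ≫ R.reductionIso.hom.left ≫ baseChangeHomFst (residueAt v) R.model.total := by
  simp only [conjReductionIso, Iso.trans_hom, Functor.mapIso_hom, Iso.app_hom, Over.comp_left, Category.assoc]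
  rw [conjReductionNatIso_hom_app_left_comp_fst_fst, ← Category.assoc]
  -- `((bcHom Frobⁿ).map e.hom).left ≫ pr = pr ≫ e.hom.left` (`R.model.reductionAt = (bcHom (residueAt v)).obj 𝒳` by `rfl`)
  have e := baseChangeHom_map_left_comp_fst (iterateFrobenius v.asIdeal.ResidueField p n) R.reductionIso.hom
  exact (congrArg (· ≫ baseChangeHomFst (residueAt v) R.model.total) e).trans (Category.assoc _ _ _)

/-- The first projection `𝒳 ⊗ κ(v) → 𝒳` of the special fibre is a monomorphism (a closed immersion: base change of
`Spec κ(v) → Spec 𝓞_{K,v}`, `residueAt v` being surjective). [cite: GortzWedhorn2020, Section (4.7)] -/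
theorem mono_baseChangeHomFst_residueAt (𝒳 : SchemeOver (valuationSubringAtPrime K v)) :
    Mono (baseChangeHomFst (residueAt v) 𝒳) := by
  haveI : IsClosedImmersion (Spec.map (CommRingCat.ofHom (residueAt v))) :=
    IsClosedImmersion.spec_of_surjective _ (residueAt_surjective v)
  haveI : IsClosedImmersion (baseChangeHomFst (residueAt v) 𝒳) := by
    change IsClosedImmersion (pullback.fst 𝒳.hom (Spec.map (CommRingCat.ofHom (residueAt v))))
    infer_instance
  infer_instance

/-- **P4 — the reading of points of `Ã^{(q)}` through the conjugate datum**: let `Q_R` be a `κ'`-point of `Ã` and `Q_S`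
a `κ'`-point of `Ã^{(q)}` (the reduction of the conjugate datum, `conjOfSquares_reduction`).  If the image of `Q_S` in the
model `𝒳` — through `conjReductionIso` and the projections `(𝒳 ⊗_{γᵥ} 𝓞_v) ⊗ κ → 𝒳 ⊗_{γᵥ} 𝓞_v → 𝒳` — is `Spec Frobⁿ_{κ'}`
followed by the image of `Q_R` in `𝒳` (through `R.reductionIso` and `𝒳 ⊗ κ → 𝒳`), then `Q_S = π(Q_R)` for the relative
`q`-Frobenius `π : Ã → Ã^{(q)}`.  (Shimura p. 129–130: the reduction of the `σ`-conjugate point read in `Ã^f` is `π` of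
the reduction.) [cite: Shimura1998, §18.6 proof of Thm. 18.6, p. 129] -/
theorem map_relFrobenius_eq_of_conjReductionIso {κ' : Type} [Field κ'] [Algebra v.asIdeal.ResidueField κ']
    [ExpChar κ' p] (Q_R : R.reduction.Points κ') (Q_S : (R.reduction.frobeniusTwist p n).Points κ')
    (h : Q_S.left ≫ (conjReductionIso R γ γᵥ h₁ p n h₂).hom.left ≫
        baseChangeHomFst (residueAt v) ((baseChangeHom γᵥ.toRingHom).obj R.model.total) ≫
          baseChangeHomFst γᵥ.toRingHom R.model.total =
      Spec.map (CommRingCat.ofHom (iterateFrobenius κ' p n)) ≫ Q_R.left ≫ R.reductionIso.hom.left ≫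
        baseChangeHomFst (residueAt v) R.model.total) :
    AlgPoints.map (R.reduction.relFrobenius p n).hom.hom.hom Q_R = Q_S := by
  apply AbelianVariety.map_relFrobenius_eq_of_left_comp_twistFst
  haveI := mono_baseChangeHomFst_residueAt (v := v) R.model.total
  haveI : Mono (R.reductionIso.hom.left ≫ baseChangeHomFst (residueAt v) R.model.total) := mono_comp _ _
  rw [← cancel_mono (R.reductionIso.hom.left ≫ baseChangeHomFst (residueAt v) R.model.total), Category.assoc,
    ← conjReductionIso_hom_left_comp_fst_fst R γ γᵥ h₁ p n h₂, h, Category.assoc]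

end GoodReductionAt

/-! ### §4. The conjugate by an arithmetic Frobenius (`GoodReductionAt.conjFrob`) -/

namespace GoodReductionAt

open NumberField IsDedekindDomain IsDedekindDomain.HeightOneSpectrum

variable {F₀ K : Type} [Field F₀] [Field K] [NumberField K] [Algebra F₀ K]
  {A₀ : AbelianVariety K} {v : HeightOneSpectrum (𝓞 K)}
  (R : A₀.GoodReductionAt v) (γ : K ≃ₐ[F₀] K) (hγ : IsArithFrobAt (𝓞 F₀) γ v.asIdeal)
  (p n : ℕ) [ExpChar v.asIdeal.ResidueField p] (hq : Nat.card (𝓞 F₀ ⧸ v.asIdeal.under (𝓞 F₀)) = p ^ n)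

/-- The model of `conjFrob` is `𝒳 ⊗_{γᵥ} 𝓞_v` for `γᵥ = algEquivValuationSubring v γ _` (by `rfl`).
[cite: Shimura1998, §18.6 proof of Thm. 18.6, p. 129] -/
theorem conjFrob_model_total :
    (R.conjFrob γ hγ p n hq).model.total =
      (baseChangeHom (algEquivValuationSubring v γ (smul_asIdeal_eq_of_isArithFrobAt v γ hγ)).toRingHom).obj
        R.model.total := rfl

/-- The reduction isomorphism of `conjFrob` is `conjReductionIso` (by `rfl`). [cite: Shimura1998, §18.6 proof of Thm. 18.6, p. 129] -/
theorem conjFrob_reductionIso :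
    (R.conjFrob γ hγ p n hq).reductionIso =
      conjReductionIso R γ.toRingEquiv (algEquivValuationSubring v γ (smul_asIdeal_eq_of_isArithFrobAt v γ hγ))
        (algebraMap_comp_algEquivValuationSubring v γ _) p n (residueAt_comp_algEquivValuationSubring v γ hγ p n hq) := rfl

/-- The generic isomorphism of `conjFrob` is that of `conjModel` (by `rfl`). [cite: Shimura1998, §18.6 proof of Thm. 18.6, p. 129] -/
theorem conjFrob_model_genericIso :
    (R.conjFrob γ hγ p n hq).model.genericIso =
      (conjModel R γ.toRingEquiv (algEquivValuationSubring v γ (smul_asIdeal_eq_of_isArithFrobAt v γ hγ))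
        (algebraMap_comp_algEquivValuationSubring v γ _)).genericIso := rfl

/-- **`conjFrob`: the reduction isomorphism against the projections** — `Ã^{(q)} ≅ (𝒳 ⊗_{γᵥ} 𝓞_v) ⊗ κ → 𝒳 ⊗_{γᵥ} 𝓞_v → 𝒳`
equals `pr : Ã^{(q)} → Ã ≅ 𝒳 ⊗ κ → 𝒳`. [cite: Shimura1998, §18.6 proof of Thm. 18.6, p. 129] -/
@[reassoc]
theorem conjFrob_reductionIso_hom_left_comp_fst_fst :
    (R.conjFrob γ hγ p n hq).reductionIso.hom.left ≫
        baseChangeHomFst (residueAt v) (R.conjFrob γ hγ p n hq).model.total ≫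
          baseChangeHomFst (algEquivValuationSubring v γ (smul_asIdeal_eq_of_isArithFrobAt v γ hγ)).toRingHom
            R.model.total =
      twistFst p n R.reduction.X ≫ R.reductionIso.hom.left ≫ baseChangeHomFst (residueAt v) R.model.total :=
  conjReductionIso_hom_left_comp_fst_fst R γ.toRingEquiv _ _ p n _

/-- **P4 for `conjFrob`** — a `κ'`-point `Q_S` of `(A₀^γ)~ = Ã^{(q)}` whose image in `𝒳` (through the reduction
isomorphism of `conjFrob` and the two projections) is `Spec Frobⁿ_{κ'} ≫` (the image of `Q_R ∈ Ã(κ')` in `𝒳`) is `π(Q_R)`.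
[cite: Shimura1998, §18.6 proof of Thm. 18.6, p. 129] -/
theorem map_relFrobenius_eq_of_conjFrob_reductionIso {κ' : Type} [Field κ'] [Algebra v.asIdeal.ResidueField κ']
    [ExpChar κ' p] (Q_R : R.reduction.Points κ') (Q_S : (R.conjFrob γ hγ p n hq).reduction.Points κ')
    (h : Q_S.left ≫ (R.conjFrob γ hγ p n hq).reductionIso.hom.left ≫
        baseChangeHomFst (residueAt v) (R.conjFrob γ hγ p n hq).model.total ≫
          baseChangeHomFst (algEquivValuationSubring v γ (smul_asIdeal_eq_of_isArithFrobAt v γ hγ)).toRingHom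
            R.model.total =
      Spec.map (CommRingCat.ofHom (iterateFrobenius κ' p n)) ≫ Q_R.left ≫ R.reductionIso.hom.left ≫
        baseChangeHomFst (residueAt v) R.model.total) :
    AlgPoints.map (R.reduction.relFrobenius p n).hom.hom.hom Q_R = Q_S :=
  map_relFrobenius_eq_of_conjReductionIso R γ.toRingEquiv _ _ p n _ Q_R Q_S h

end GoodReductionAt

end AbelianVariety

end Literature.AlgebraicGeometry.Motives

end
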